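import Literature.NumberTheory.EllipticCurves.EtaQuotientQExpansionProofs
import HarnessLib

/-!
# Computable coefficient tables for the truncated Euler products `∏ (1 − Xⁿ)^s`

Cell `bsd-f2-manin`, route `ManinLocalTwoThree` (crux C2 `ManinOddAtFour`, stmt-BirchSwinnertonDyer-22967), LEAD p1 gen 24 —
toolkit file (sibling of `…QRemainderCalculus`, `…QCoefficientBridge`); `--supports stmt-BirchSwinnertonDyer-22967` (helper).

`Literature/NumberTheory/EllipticCurves/EtaQuotientQExpansionProofs.lean` defines the integer formal power
series `formalEulerPow s = ∏_{n ≥ 1} (1 − Xⁿ)^s` through the truncated products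
`eulerTrunc s N = ∏_{m < N} (1 − X^{m+1})^s` (`coeff_formalEulerPow : coeff n (formalEulerPow s) = coeff n (eulerTrunc s N)`
for `n ≤ N`), and uses them analytically (`hasSum_formalEulerPow`, `hasSum_eulerFn`: the `q`-series of
`∏ (1 − q^{δn})` on `ℍ`).  What the tree lacked is a way to EVALUATE these coefficients: the only table so far is
`coeff_formalEulerPow_one_of_le_two` (`n ≤ 2`, by `ring` on power series), and every `η`-quotient `q`-expansion
certificate of the Manin `c = ±1` level programme (`…ManinLocalTwoThreeEulerRemainders*`) is built on it.  Level 44 of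
that programme needs `∏ (1 − qⁿ)` and `∏ (1 − qⁿ)²` through `q³³`.

This file gives a KERNEL-COMPUTABLE model: `mulOneSubXPowList k l` multiplies a coefficient list (a power series
truncated to `length l` coefficients) by `1 − X^k`, `eulerTruncList s M N` is the list of the first `M + 1` coefficients of
`eulerTrunc s N`, and

* `getD_eulerTruncList` : `(eulerTruncList s M N).getD n 0 = coeff n (eulerTrunc s N)` for `n ≤ M`;
* `coeff_formalEulerPow_eq_getD` : `coeff n (formalEulerPow s) = (eulerTruncList s M M).getD n 0` for `n ≤ M`;

so that any finite table of coefficients of `∏ (1 − Xⁿ)^s` is proved by `decide`.  As instances (the ones the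
level-44 files consume): Euler's pentagonal numbers `coeff_formalEulerPow_one_le_forty` (`∏(1 − Xⁿ) = 1 − X − X² + X⁵
+ X⁷ − X¹² − X¹⁵ + X²² + X²⁶ − X³⁵ − X⁴⁰ + ⋯`) and the square `coeff_formalEulerPow_two_le_forty`.  Pure algebra over
`ℤ⟦X⟧`; no analysis, no named fact.

## References
* [Apostol1990] T. M. Apostol, Modular Functions and Dirichlet Series in Number Theory, 2nd ed., GTM 41, §1.? —
  Euler's pentagonal number theorem, Thm. 14.3 of the companion volume (Introduction to Analytic Number Theory).
* [Koehler2011] G. Köhler, Eta Products and Theta Series Identities, Springer Monographs in Mathematics (2011), §1.1.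
-/

set_option autoImplicit false
-- lint-debt: the directory name repeats the summit name (sibling precedent `ManinLocalTwoThreeQRemainderCalculus.lean`)
set_option linter.dupNamespace false

namespace Summit.BirchSwinnertonDyer.BirchSwinnertonDyer.Theorems.ManinLocalTwoThree.EulerTables

open PowerSeries Literature.NumberTheory.EllipticCurves.ModularForms

/-! ## 1. Lists as truncated power series -/

/-- Multiply a truncated coefficient list by `1 − X^k` (keeping the same truncation length). [folklore] -/
def mulOneSubXPowList (k : ℕ) (l : List ℤ) : List ℤ :=
  (List.range l.length).map fun n ↦ l.getD n 0 - if k ≤ n then l.getD (n - k) 0 else 0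

/-- The first `M + 1` coefficients of `eulerTrunc s N = ∏_{m < N} (1 − X^{m+1})^s`, computed by iterated list
multiplication. [folklore] -/
def eulerTruncList (s M : ℕ) : ℕ → List ℤ
  | 0 => (List.range (M + 1)).map fun n ↦ if n = 0 then 1 else 0
  | N + 1 => (mulOneSubXPowList (N + 1))^[s] (eulerTruncList s M N)

/-- Entries of a mapped range. [folklore] -/
theorem getD_map_range (f : ℕ → ℤ) (L n : ℕ) :
    ((List.range L).map f).getD n 0 = if n < L then f n else 0 := by
  rw [List.getD_eq_getElem?_getD, List.getElem?_map]
  split_ifs with h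
  · rw [List.getElem?_range h]; rfl
  · rw [List.getElem?_eq_none (by simpa using Nat.le_of_not_lt h)]; rfl

/-- `mulOneSubXPowList` preserves the truncation length. [folklore] -/
@[simp] theorem length_mulOneSubXPowList (k : ℕ) (l : List ℤ) : (mulOneSubXPowList k l).length = l.length := by
  simp [mulOneSubXPowList]

/-- Entries of `mulOneSubXPowList`. [folklore] -/
theorem getD_mulOneSubXPowList (k : ℕ) (l : List ℤ) (n : ℕ) :
    (mulOneSubXPowList k l).getD n 0 =
      if n < l.length then l.getD n 0 - (if k ≤ n then l.getD (n - k) 0 else 0) else 0 :=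
  getD_map_range _ _ _

/-- **Multiplication by `1 − X^k` on coefficients**: if `l` lists the first `length l` coefficients of `φ`, then
`mulOneSubXPowList k l` lists those of `φ · (1 − X^k)`. [folklore] -/
theorem getD_mulOneSubXPowList_eq_coeff (k : ℕ) {l : List ℤ} {φ : PowerSeries ℤ}
    (h : ∀ n < l.length, l.getD n 0 = coeff n φ) (n : ℕ) (hn : n < l.length) :
    (mulOneSubXPowList k l).getD n 0 = coeff n (φ * (1 - X ^ k)) := by
  rw [getD_mulOneSubXPowList, if_pos hn, mul_sub, mul_one, map_sub, coeff_mul_X_pow', h n hn]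
  split_ifs with hk
  · rw [h (n - k) (lt_of_le_of_lt (Nat.sub_le n k) hn)]
  · rfl

/-- Iterating: `(mulOneSubXPowList k)^[s] l` lists the coefficients of `φ · (1 − X^k)^s`. [folklore] -/
theorem getD_iterate_mulOneSubXPowList_eq_coeff (k s : ℕ) :
    ∀ {l : List ℤ} {φ : PowerSeries ℤ}, (∀ n < l.length, l.getD n 0 = coeff n φ) →
      ((mulOneSubXPowList k)^[s] l).length = l.length ∧
        ∀ n < l.length, ((mulOneSubXPowList k)^[s] l).getD n 0 = coeff n (φ * (1 - X ^ k) ^ s) := by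
  induction s with
  | zero => intro l φ h; exact ⟨rfl, fun n hn ↦ by rw [Function.iterate_zero, id, pow_zero, mul_one, h n hn]⟩
  | succ s ih =>
    intro l φ h
    have h1 := getD_mulOneSubXPowList_eq_coeff k h
    have hlen : (mulOneSubXPowList k l).length = l.length := length_mulOneSubXPowList k l
    obtain ⟨hl, hc⟩ := ih (l := mulOneSubXPowList k l) (φ := φ * (1 - X ^ k))
      (fun n hn ↦ h1 n (by rwa [hlen] at hn))
    refine ⟨by rw [Function.iterate_succ_apply, hl, hlen], fun n hn ↦ ?_⟩
    rw [Function.iterate_succ_apply, hc n (by rwa [hlen]), pow_succ', ← mul_assoc]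

/-- **`eulerTruncList s M N` lists the first `M + 1` coefficients of `eulerTrunc s N`.** [folklore] -/
theorem eulerTruncList_spec (s M N : ℕ) :
    (eulerTruncList s M N).length = M + 1 ∧
      ∀ n < M + 1, (eulerTruncList s M N).getD n 0 = coeff n (eulerTrunc s N) := by
  induction N with
  | zero =>
    refine ⟨by simp [eulerTruncList], fun n hn ↦ ?_⟩
    rw [eulerTruncList, getD_map_range, if_pos hn, eulerTrunc, Finset.prod_range_zero, coeff_one]
  | succ N ih =>
    obtain ⟨hlen, hc⟩ := ih
    have h := getD_iterate_mulOneSubXPowList_eq_coeff (N + 1) s (l := eulerTruncList s M N)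
      (φ := eulerTrunc s N) (fun n hn ↦ hc n (by rwa [hlen] at hn))
    rw [hlen] at h
    refine ⟨by rw [eulerTruncList]; exact h.1, fun n hn ↦ ?_⟩
    rw [eulerTruncList, h.2 n hn, eulerTrunc, eulerTrunc, Finset.prod_range_succ]

/-- `(eulerTruncList s M N).getD n 0 = coeff n (eulerTrunc s N)` for `n ≤ M`. [folklore] -/
theorem getD_eulerTruncList {s M N n : ℕ} (hn : n ≤ M) :
    (eulerTruncList s M N).getD n 0 = coeff n (eulerTrunc s N) :=
  (eulerTruncList_spec s M N).2 n (Nat.lt_succ_of_le hn)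

/-- **`coeff n (∏ (1 − Xⁿ)^s) = (eulerTruncList s M M).getD n 0` for `n ≤ M`** — the computable form of
`coeff_formalEulerPow`. [folklore] -/
theorem coeff_formalEulerPow_eq_getD {s M n : ℕ} (hn : n ≤ M) :
    coeff n (formalEulerPow s) = (eulerTruncList s M M).getD n 0 := by
  rw [coeff_formalEulerPow hn, getD_eulerTruncList hn]

/-! ## 2. Tables: Euler's pentagonal numbers and the square, through degree `40` -/

/-- The first `41` coefficients of `∏ (1 − Xⁿ)` (kernel evaluation). [folklore] -/
theorem eulerTruncList_one_forty : eulerTruncList 1 40 40 =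
    [1, -1, -1, 0, 0, 1, 0, 1, 0, 0, 0, 0, -1, 0, 0, -1, 0, 0, 0, 0, 0, 0, 1, 0, 0, 0, 1, 0, 0, 0, 0, 0, 0, 0, 0,
      -1, 0, 0, 0, 0, -1] := by
  decide +kernel

/-- **Euler's pentagonal number theorem, through degree `40`**: `coeff n ∏(1 − Xᵐ)` is `1` at `n = 0, 5, 7, 22, 26`,
`−1` at `n = 1, 2, 12, 15, 35, 40`, and `0` at every other `n ≤ 40` (`n = k(3k ∓ 1)/2`, sign `(−1)^k`).
[cite: Apostol1990, Thm. 14.3 (Introduction to Analytic Number Theory)] -/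
theorem coeff_formalEulerPow_one_le_forty (n : ℕ) (hn : n ≤ 40) :
    coeff n (formalEulerPow 1) =
      if n = 0 ∨ n = 5 ∨ n = 7 ∨ n = 22 ∨ n = 26 then 1
      else if n = 1 ∨ n = 2 ∨ n = 12 ∨ n = 15 ∨ n = 35 ∨ n = 40 then -1 else 0 := by
  rw [coeff_formalEulerPow_eq_getD hn, eulerTruncList_one_forty]
  interval_cases n <;> rfl

/-- The first `41` coefficients of `∏ (1 − Xⁿ)²` (kernel evaluation). [folklore] -/
theorem eulerTruncList_two_forty : eulerTruncList 2 40 40 =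
    [1, -2, -1, 2, 1, 2, -2, 0, -2, -2, 1, 0, 0, 2, 3, -2, 2, 0, 0, -2, -2, 0, 0, -2, -1, 0, 2, 2, -2, 2, 1, 2,
      0, 2, -2, -2, 2, 0, -2, 0, -4] := by
  decide +kernel

/-- **`coeff n ∏(1 − Xᵐ)²` through degree `40`** (the `q`-expansion of `η(τ)²/q^{1/12}`), as a table.
[cite: Koehler2011, §1.1] -/
theorem coeff_formalEulerPow_two_le_forty (n : ℕ) (hn : n ≤ 40) :
    coeff n (formalEulerPow 2) =
      [1, -2, -1, 2, 1, 2, -2, 0, -2, -2, 1, 0, 0, 2, 3, -2, 2, 0, 0, -2, -2, 0, 0, -2, -1, 0, 2, 2, -2, 2, 1, 2,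
        0, 2, -2, -2, 2, 0, -2, 0, -4].getD n 0 := by
  rw [coeff_formalEulerPow_eq_getD hn, eulerTruncList_two_forty]

end Summit.BirchSwinnertonDyer.BirchSwinnertonDyer.Theorems.ManinLocalTwoThree.EulerTables
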